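import Mathlib
import HarnessLib
import Literature.Probability.MarkovChains.ProductChains
import Literature.Probability.MarkovChains.LogSobolevConstant
import Literature.Probability.Entropy.PinskerInequality

/-!
# Tensorization of KL, `χ²` and total variation over finite product laws

[cite: PolyanskiyWu2024, Thm 2.16(d); §7.12 eq. (7.79); Exercise I.43; Thm 7.7(b) eq. (7.20);
Thm 7.10]

For laws `P_1,…,P_d`, `Q_1,…,Q_d` on finite sets `X_1,…,X_d` (functions `P j : X j → ℝ`) write
`P̃ = P_1 ⊗ ⋯ ⊗ P_d` for the product law on `Π_j X_j` — the tree's `tensorFun P`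
(`MarkovChains/ProductChains.lean`, `(⊗φ)(x) = Π_j φ_j(x_j)`).  This file PROVES (finite sums, 0 named
facts) how the three divergences used by the venture's volume laws behave under `⊗`:

* **KL is additive** `relEnt_tensorFun` — "(Tensorization)
  `D(Π_{j=1}^n P_{X_j} ‖ Π_{j=1}^n Q_{X_j}) = Σ_{j=1}^n D(P_{X_j} ‖ Q_{X_j})`"
  [cite: PolyanskiyWu2024, Thm 2.16(d)], with `D = relEnt` of `MarkovChains/LogSobolevConstant.lean`
  (`Σ_x m(x) log(m(x)/π(x))`, natural logarithm — the finite sum of `PinskerInequality.lean`);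
  i.i.d. case `relEnt_tensorFun_const` (`D(P^{⊗n}‖Q^{⊗n}) = n·D(P‖Q)`);
* **`χ²` is multiplicative** `sum_sq_div_tensorFun` / `chiSq_tensorFun` —
  "`1 + χ²(Π_{i=1}^n P_i ‖ Π_{i=1}^n Q_i) = Π_{i=1}^n (1 + χ²(P_i ‖ Q_i))`"
  [cite: PolyanskiyWu2024, §7.12 (display after eq. (7.79))] (`1 + χ² = Σ_x P(x)²/Q(x)`; the
  `χ²`-sum `Σ_x (P(x) − Q(x))²/Q(x)` is written out, as in `LogSobolevElementaryBounds.lean`);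
* **TV is subadditive** `PolyanskiyWu2024_ex_I_43_b` (`TV(P̃,Q̃) ≤ Σ_j TV(P_j,Q_j)`) — the product
  case of "`TV(P_{X^n},Q_{X^n}) ≤ Σ_{i=1}^n E_{P_{X^{i−1}}} TV(P_{X_i|X^{i−1}}, Q_{X_i|X^{i−1}})`"
  [cite: PolyanskiyWu2024, Exercise I.43(b)]; its path `P_i = P_{X^i}Q_{X^n_{i+1}}` of hybrid laws
  [cite: PolyanskiyWu2024, Exercise I.43(a)] changes ONE factor at a time, and for one factor the
  distance is exact: `tvDist_tensorFun_update` (`TV(⊗φ, ⊗(φ with φ_k ← g)) = TV(φ_k, g)`).  We derive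
  the subadditivity from the sharper PRODUCT-COUPLING form `tvDist_tensorFun_le_one_sub_prod`
  (`TV(P̃,Q̃) ≤ 1 − Π_j (1 − TV(P_j,Q_j))`): by the coupling representation "`TV(P,Q) =
  min {P[X ≠ Y] : P_X = P, P_Y = Q}`" [cite: PolyanskiyWu2024, Thm 7.7(b) eq. (7.20)] evaluated at the
  product of coordinatewise optimal couplings, `P[X = Y] = Π_j (1 − TV(P_j,Q_j))`; here it is proved
  directly from `1 − TV(μ,ν) = Σ min(μ,ν)` [cite: PolyanskiyWu2024, §7.1 eq. (7.3)] and
  `min(Π a_j, Π b_j) ≥ Π_j min(a_j,b_j)`, and the printed `Σ` form follows from the Weierstrass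
  product inequality `Π_j (1 − t_j) ≥ 1 − Σ_j t_j` (private helpers);
* **tests** (no product structure): for any randomised test `φ : Y → [0,1]` between two laws the two
  error probabilities add up to at least `1 − TV` (`PolyanskiyWu2024_eq_7_19_ge`), with equality for the
  likelihood-ratio test `φ = 1{P < Q}` (`PolyanskiyWu2024_eq_7_19_eq`): "the minimal total error
  probability … `min_φ {P[φ(X) = 1] + Q[φ(X) = 0]} = 1 − TV(P,Q)`" [cite: PolyanskiyWu2024, Thm 7.7(a)
  eq. (7.19)] — both from `TV + Σ min(P,Q) = 1` (`tvDist_add_sum_min_eq_one`, eq. (7.3));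
* **Pinsker for products** `two_mul_tvDist_tensorFun_sq_le`, `tvDist_tensorFun_le_sqrt`
  (`TV(P̃,Q̃) ≤ √(Σ_j D(P_j‖Q_j)/2)`), i.i.d. `tvDist_tensorFun_const_le_sqrt` (`≤ √(n·D(P‖Q)/2)`):
  the tree's sharp Pinsker `two_mul_tvDist_sq_le_kl` [cite: PolyanskiyWu2024, Thm 7.10] composed with
  Thm 2.16(d) — the `√n` growth that makes "computing the total variation between two `n`-fold product
  distributions" tractable through a tensorizing divergence [cite: PolyanskiyWu2024, §7.3].

Context (cell pub-lqcd, venture LatticeQCDFlow): a factorised sampler on `V` sites has a product law;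
its distance to a product target, hence any acceptance or distinguishability figure built on TV,
obeys `TV ≤ min(Σ_j TV_j, √(Σ_j D_j/2), 1 − Π_j(1 − TV_j))`, i.e. grows at most like `V·TV_1` and
like `√(V·D_1)`.  (The Hellinger/Bhattacharyya tensorization (7.26) and the matching LOWER bounds
belong with `Entropy/BretagnolleHuber.lean` and are not restated here.)
-/

namespace Literature.Probability.Entropy

open Finset Real Function
open Literature.Probability.MarkovChains

/-! ## Two elementary real inequalities -/

/-- `Π_{i∈s} min(a_i,b_i) ≤ min(Π_{i∈s} a_i, Π_{i∈s} b_i)` for `a, b ≥ 0` on `s`. [folklore]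
(private helper) -/
private theorem prod_min_le_min_prod {ι : Type*} (s : Finset ι) (a b : ι → ℝ) (ha : ∀ i ∈ s, 0 ≤ a i)
    (hb : ∀ i ∈ s, 0 ≤ b i) :
    ∏ i ∈ s, min (a i) (b i) ≤ min (∏ i ∈ s, a i) (∏ i ∈ s, b i) :=
  le_min (prod_le_prod (fun i hi => le_min (ha i hi) (hb i hi)) fun _ _ => min_le_left _ _)
    (prod_le_prod (fun i hi => le_min (ha i hi) (hb i hi)) fun _ _ => min_le_right _ _)

/-- Weierstrass's product inequality `1 − Σ_{i∈s} t_i ≤ Π_{i∈s} (1 − t_i)` for `0 ≤ t_i ≤ 1`.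
[folklore] (private helper) -/
private theorem one_sub_sum_le_prod_one_sub {ι : Type*} (s : Finset ι) (t : ι → ℝ)
    (h0 : ∀ i ∈ s, 0 ≤ t i) (h1 : ∀ i ∈ s, t i ≤ 1) :
    1 - ∑ i ∈ s, t i ≤ ∏ i ∈ s, (1 - t i) := by
  classical
  revert h0 h1
  refine Finset.induction_on s (fun _ _ => by simp) ?_
  intro a s has ih h0 h1
  rw [sum_insert has, prod_insert has]
  have ha0 : 0 ≤ t a := h0 a (mem_insert_self a s)
  have ha1 : t a ≤ 1 := h1 a (mem_insert_self a s)
  have ih' := ih (fun i hi => h0 i (mem_insert_of_mem hi)) fun i hi => h1 i (mem_insert_of_mem hi)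
  have hS : 0 ≤ ∑ i ∈ s, t i := sum_nonneg fun i hi => h0 i (mem_insert_of_mem hi)
  nlinarith [mul_le_mul_of_nonneg_left ih' (sub_nonneg.2 ha1), mul_nonneg ha0 hS]

/-- `TV(μ,ν) + Σ_y min(μ(y),ν(y)) = 1` for two laws of mass one ("`TV = 1 − ∫ d(P∧Q)`").
[cite: PolyanskiyWu2024, §7.1 eq. (7.3)] -/
theorem tvDist_add_sum_min_eq_one {Y : Type*} [Fintype Y] {μ ν : Y → ℝ} (hμ1 : ∑ y, μ y = 1)
    (hν1 : ∑ y, ν y = 1) : tvDist μ ν + ∑ y, min (μ y) (ν y) = 1 := by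
  unfold tvDist
  have e : ∀ y, |μ y - ν y| = μ y + ν y - 2 * min (μ y) (ν y) := fun y => by
    rcases le_total (μ y) (ν y) with h | h
    · rw [min_eq_left h, abs_of_nonpos (by linarith)]; ring
    · rw [min_eq_right h, abs_of_nonneg (by linarith)]; ring
  simp_rw [e, sum_sub_distrib, sum_add_distrib, ← mul_sum, hμ1, hν1]
  ring

/-! ## Tests: the minimal total error probability (Thm 7.7(a) eq. (7.19)) -/

/-- For any randomised test `φ : Y → [0,1]` deciding between two laws `P, Q` (say `φ = 1` means "reject
`P`"), the two error probabilities add up to at least `1 − TV(P,Q)`: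
`Σ_y P(y)φ(y) + Σ_y Q(y)(1 − φ(y)) ≥ 1 − TV(P,Q)`. [cite: PolyanskiyWu2024, Thm 7.7(a) eq. (7.19)
("the minimal total error probability … `= 1 − TV(P,Q)`")] -/
theorem PolyanskiyWu2024_eq_7_19_ge {Y : Type*} [Fintype Y] {P Q : Y → ℝ} (hP1 : ∑ y, P y = 1)
    (hQ1 : ∑ y, Q y = 1) {φ : Y → ℝ} (hφ0 : ∀ y, 0 ≤ φ y) (hφ1 : ∀ y, φ y ≤ 1) :
    1 - tvDist P Q ≤ ∑ y, P y * φ y + ∑ y, Q y * (1 - φ y) := by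
  have h := tvDist_add_sum_min_eq_one hP1 hQ1
  rw [← sum_add_distrib]
  have hle : ∑ y, min (P y) (Q y) ≤ ∑ y, (P y * φ y + Q y * (1 - φ y)) :=
    sum_le_sum fun y _ => by
      rcases le_total (P y) (Q y) with hpq | hqp
      · rw [min_eq_left hpq]
        nlinarith [mul_le_mul_of_nonneg_right hpq (sub_nonneg.2 (hφ1 y))]
      · rw [min_eq_right hqp]
        nlinarith [mul_le_mul_of_nonneg_right hqp (hφ0 y)]
  linarith

/-- … and the likelihood-ratio test `φ = 1{P < Q}` attains it:
`P[φ = 1] + Q[φ = 0] = Σ_y min(P(y),Q(y)) = 1 − TV(P,Q)`, so that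
"`min_φ {P[φ(X) = 1] + Q[φ(X) = 0]} = 1 − TV(P,Q)`". [cite: PolyanskiyWu2024, Thm 7.7(a) eq. (7.19)] -/
theorem PolyanskiyWu2024_eq_7_19_eq {Y : Type*} [Fintype Y] {P Q : Y → ℝ} (hP1 : ∑ y, P y = 1)
    (hQ1 : ∑ y, Q y = 1) :
    ∑ y, P y * (if P y < Q y then (1 : ℝ) else 0) + ∑ y, Q y * (1 - if P y < Q y then (1 : ℝ) else 0)
      = 1 - tvDist P Q := by
  have h := tvDist_add_sum_min_eq_one hP1 hQ1
  rw [← sum_add_distrib]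
  have e : ∀ y, P y * (if P y < Q y then (1 : ℝ) else 0) + Q y * (1 - if P y < Q y then (1 : ℝ) else 0)
      = min (P y) (Q y) := fun y => by
    split_ifs with hlt
    · rw [min_eq_left hlt.le]; ring
    · rw [min_eq_right (not_lt.1 hlt)]; ring
  simp_rw [e]
  linarith

section Product

variable {d : ℕ} {X : Fin d → Type*} [∀ j, Fintype (X j)]

/-! ## Changing one factor -/

omit [∀ j, Fintype (X j)] in
/-- `⊗(φ with φ_k ← g)(x) = g(x_k) · Π_{i ≠ k} φ_i(x_i)`. [cite: PolyanskiyWu2024, Exercise I.43(a)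
(the hybrid laws `P_i = P_{X^i} Q_{X^n_{i+1}}` differ from their neighbours in one factor)] -/
theorem tensorFun_updateFactor (φ : ∀ j, X j → ℝ) (k : Fin d) (g : X k → ℝ) (x : ∀ j, X j) :
    tensorFun (update φ k g) x = g (x k) * ∏ i ∈ univ \ {k}, φ i (x i) := by
  rw [tensorFun_eq_mul_prod (update φ k g) x k, update_self]
  congr 1
  exact prod_congr rfl fun i hi => by
    have hik : i ≠ k := by simpa [mem_sdiff] using hi
    rw [update_of_ne hik]

/-- `Σ_x |⊗φ(x) − ⊗(φ with φ_k ← g)(x)| = (Σ_u |φ_k(u) − g(u)|) · Π_{i ≠ k} Σ_u φ_i(u)` when the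
untouched factors are non-negative. [cite: PolyanskiyWu2024, Exercise I.43(a)–(b) (one step of the
path)] -/
theorem sum_abs_tensorFun_sub_updateFactor (φ : ∀ j, X j → ℝ) (k : Fin d) (g : X k → ℝ)
    (hφ : ∀ i, i ≠ k → ∀ u, 0 ≤ φ i u) :
    ∑ x : ∀ j, X j, |tensorFun φ x - tensorFun (update φ k g) x|
      = (∑ u, |φ k u - g u|) * ∏ i ∈ univ \ {k}, ∑ u, φ i u := by
  have hpt : ∀ x : ∀ j, X j, |tensorFun φ x - tensorFun (update φ k g) x|
      = tensorFun (update φ k (fun u => |φ k u - g u|)) x := by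
    intro x
    have hR : 0 ≤ ∏ i ∈ univ \ {k}, φ i (x i) :=
      prod_nonneg fun i hi => hφ i (by simpa [mem_sdiff] using hi) (x i)
    rw [tensorFun_updateFactor φ k (fun u => |φ k u - g u|) x, tensorFun_updateFactor φ k g x,
      tensorFun_eq_mul_prod φ x k, ← sub_mul, abs_mul, abs_of_nonneg hR]
  simp_rw [hpt]
  rw [sum_tensorFun]
  have hs : ∀ j, ∑ u, update φ k (fun u => |φ k u - g u|) j u
      = update (fun j => ∑ u, φ j u) k (∑ u, |φ k u - g u|) j := by
    intro j
    by_cases hjk : j = k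
    · subst hjk
      rw [update_self, update_self]
    · rw [update_of_ne hjk, update_of_ne hjk]
  rw [prod_congr rfl fun j _ => hs j, prod_update_of_mem (mem_univ k)]

/-- **Changing one factor changes the product law by exactly that much**:
`TV(⊗φ, ⊗(φ with φ_k ← g)) = TV(φ_k, g)` when every other factor is a law (non-negative, mass one).
[cite: PolyanskiyWu2024, Exercise I.43(a)–(b) (each step of the path `P_i = P_{X^i}Q_{X^n_{i+1}}`
costs `TV(P_{X_i}, Q_{X_i})` in the product case)] -/
theorem tvDist_tensorFun_update (φ : ∀ j, X j → ℝ) (k : Fin d) (g : X k → ℝ)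
    (hφ0 : ∀ i, i ≠ k → ∀ u, 0 ≤ φ i u) (hφ1 : ∀ i, i ≠ k → ∑ u, φ i u = 1) :
    tvDist (tensorFun φ) (tensorFun (update φ k g)) = tvDist (φ k) g := by
  unfold tvDist
  rw [sum_abs_tensorFun_sub_updateFactor φ k g hφ0,
    prod_eq_one fun i hi => hφ1 i (by simpa [mem_sdiff] using hi), mul_one]

/-! ## KL divergence: additivity (Thm 2.16(d)) -/

/-- **Tensorization of the KL divergence** [cite: PolyanskiyWu2024, Thm 2.16(d)]:
`D(P_1 ⊗ ⋯ ⊗ P_d ‖ Q_1 ⊗ ⋯ ⊗ Q_d) = Σ_j D(P_j ‖ Q_j)` for laws `P_j` (mass one) and `Q_j` without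
zeros (natural logarithm, `D = relEnt`). -/
theorem relEnt_tensorFun (P Q : ∀ j, X j → ℝ) (hP1 : ∀ j, ∑ u, P j u = 1)
    (hQ : ∀ j u, Q j u ≠ 0) :
    relEnt (tensorFun P) (tensorFun Q) = ∑ j, relEnt (P j) (Q j) := by
  unfold relEnt
  have hpt : ∀ x : ∀ j, X j, tensorFun P x * Real.log (tensorFun P x / tensorFun Q x)
      = ∑ j, tensorFun P x * Real.log (P j (x j) / Q j (x j)) := by
    intro x
    rw [← mul_sum]
    by_cases hx : tensorFun P x = 0
    · rw [hx, zero_mul, zero_mul]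
    · have hx' : ∏ j, P j (x j) ≠ 0 := hx
      have hne : ∀ j, P j (x j) ≠ 0 := fun j => (prod_ne_zero_iff.1 hx') j (mem_univ j)
      congr 1
      unfold tensorFun
      rw [← prod_div_distrib]
      exact Real.log_prod fun j _ => div_ne_zero (hne j) (hQ j (x j))
  simp_rw [hpt]
  rw [sum_comm]
  exact sum_congr rfl fun j _ => sum_tensorFun_mul_apply P hP1 j fun u => Real.log (P j u / Q j u)

/-- The i.i.d. case: `D(P^{⊗n} ‖ Q^{⊗n}) = n · D(P ‖ Q)`. [cite: PolyanskiyWu2024, Thm 2.16(d)] -/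
theorem relEnt_tensorFun_const {Y : Type*} [Fintype Y] (n : ℕ) (P Q : Y → ℝ)
    (hP1 : ∑ u, P u = 1) (hQ : ∀ u, Q u ≠ 0) :
    relEnt (tensorFun fun _ : Fin n => P) (tensorFun fun _ : Fin n => Q) = n * relEnt P Q := by
  rw [relEnt_tensorFun (fun _ : Fin n => P) (fun _ => Q) (fun _ => hP1) fun _ => hQ, sum_const,
    card_univ, Fintype.card_fin, nsmul_eq_mul]

/-! ## `χ²`: multiplicativity of `1 + χ²` (§7.12) -/

/-- **Tensorization of `χ²`** in the form `Σ_x P̃(x)²/Q̃(x) = Π_j Σ_u P_j(u)²/Q_j(u)` (for laws,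
`Σ_x P(x)²/Q(x) = 1 + χ²(P‖Q)`): "`1 + χ²(Π_i P_i ‖ Π_i Q_i) = Π_i (1 + χ²(P_i ‖ Q_i))`".
[cite: PolyanskiyWu2024, §7.12 (display after eq. (7.79))] -/
theorem sum_sq_div_tensorFun (P Q : ∀ j, X j → ℝ) :
    ∑ x : ∀ j, X j, tensorFun P x ^ 2 / tensorFun Q x = ∏ j, ∑ u, P j u ^ 2 / Q j u := by
  have hpt : ∀ x : ∀ j, X j, tensorFun P x ^ 2 / tensorFun Q x
      = tensorFun (fun j u => P j u ^ 2 / Q j u) x := by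
    intro x
    unfold tensorFun
    rw [prod_div_distrib, prod_pow]
  simp_rw [hpt]
  exact sum_tensorFun _

/-- `Σ_x (P(x) − Q(x))²/Q(x) = Σ_x P(x)²/Q(x) − 1` for laws of mass one, `Q` without zeros
(`χ² = (1 + χ²) − 1`). [cite: PolyanskiyWu2024, §7.1 (`χ²(P‖Q) = ∫ (dP/dQ)² dQ − 1`)] -/
theorem sum_sq_sub_div_eq {Y : Type*} [Fintype Y] {P Q : Y → ℝ} (hP1 : ∑ y, P y = 1)
    (hQ1 : ∑ y, Q y = 1) (hQ : ∀ y, Q y ≠ 0) :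
    ∑ y, (P y - Q y) ^ 2 / Q y = ∑ y, P y ^ 2 / Q y - 1 := by
  have e : ∀ y, (P y - Q y) ^ 2 / Q y = P y ^ 2 / Q y - 2 * P y + Q y := fun y => by
    field_simp [hQ y]
    ring
  simp_rw [e, sum_add_distrib, sum_sub_distrib, ← mul_sum, hP1, hQ1]
  ring

/-- **Tensorization of `χ²`** as printed: `1 + χ²(P̃ ‖ Q̃) = Π_j (1 + χ²(P_j ‖ Q_j))` with
`χ²(P‖Q) = Σ_x (P(x) − Q(x))²/Q(x)`, for laws of mass one, `Q_j` without zeros.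
[cite: PolyanskiyWu2024, §7.12 (display after eq. (7.79))] -/
theorem chiSq_tensorFun (P Q : ∀ j, X j → ℝ) (hP1 : ∀ j, ∑ u, P j u = 1)
    (hQ1 : ∀ j, ∑ u, Q j u = 1) (hQ : ∀ j u, Q j u ≠ 0) :
    1 + ∑ x : ∀ j, X j, (tensorFun P x - tensorFun Q x) ^ 2 / tensorFun Q x
      = ∏ j, (1 + ∑ u, (P j u - Q j u) ^ 2 / Q j u) := by
  have hQt : ∀ x : ∀ j, X j, tensorFun Q x ≠ 0 := fun x =>
    prod_ne_zero_iff.2 fun j _ => hQ j (x j)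
  rw [sum_sq_sub_div_eq (sum_tensorFun_eq_one P hP1) (sum_tensorFun_eq_one Q hQ1) hQt,
    sum_sq_div_tensorFun]
  simp_rw [sum_sq_sub_div_eq (hP1 _) (hQ1 _) (hQ _)]
  ring_nf

/-! ## Total variation: the product coupling bound and subadditivity (Exercise I.43(b)) -/

/-- **Product-coupling bound**: `TV(P_1 ⊗ ⋯ ⊗ P_d, Q_1 ⊗ ⋯ ⊗ Q_d) ≤ 1 − Π_j (1 − TV(P_j,Q_j))` for
laws `P_j, Q_j` (non-negative, mass one).  [cite: PolyanskiyWu2024, Thm 7.7(b) eq. (7.20)] (the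
coupling representation `TV(P,Q) = min P[X ≠ Y]` evaluated at the product of coordinatewise optimal
couplings, `P[X = Y] = Π_j (1 − TV(P_j,Q_j))`); proved here without couplings, from
`1 − TV = Σ min` [cite: PolyanskiyWu2024, §7.1 eq. (7.3)] and `min(Π a, Π b) ≥ Π min(a_j, b_j)`. -/
theorem tvDist_tensorFun_le_one_sub_prod (P Q : ∀ j, X j → ℝ) (hP0 : ∀ j u, 0 ≤ P j u)
    (hQ0 : ∀ j u, 0 ≤ Q j u) (hP1 : ∀ j, ∑ u, P j u = 1) (hQ1 : ∀ j, ∑ u, Q j u = 1) :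
    tvDist (tensorFun P) (tensorFun Q) ≤ 1 - ∏ j, (1 - tvDist (P j) (Q j)) := by
  have hprod := tvDist_add_sum_min_eq_one (sum_tensorFun_eq_one P hP1) (sum_tensorFun_eq_one Q hQ1)
  have hfac : ∀ j, 1 - tvDist (P j) (Q j) = ∑ u, min (P j u) (Q j u) := fun j => by
    have := tvDist_add_sum_min_eq_one (hP1 j) (hQ1 j)
    linarith
  simp_rw [hfac]
  rw [← sum_tensorFun]
  have hle : ∑ x : ∀ j, X j, tensorFun (fun j u => min (P j u) (Q j u)) x
      ≤ ∑ x : ∀ j, X j, min (tensorFun P x) (tensorFun Q x) :=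
    sum_le_sum fun x _ => prod_min_le_min_prod univ (fun j => P j (x j)) (fun j => Q j (x j))
      (fun j _ => hP0 j (x j)) fun j _ => hQ0 j (x j)
  linarith

/-- **Subadditivity of total variation over products** [cite: PolyanskiyWu2024, Exercise I.43(b)]
(product case of `TV(P_{X^n},Q_{X^n}) ≤ Σ_i E_{P_{X^{i−1}}} TV(P_{X_i|X^{i−1}}, Q_{X_i|X^{i−1}})`):
`TV(P_1 ⊗ ⋯ ⊗ P_d, Q_1 ⊗ ⋯ ⊗ Q_d) ≤ Σ_j TV(P_j, Q_j)` for laws `P_j, Q_j`. -/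
theorem PolyanskiyWu2024_ex_I_43_b (P Q : ∀ j, X j → ℝ) (hP0 : ∀ j u, 0 ≤ P j u)
    (hQ0 : ∀ j u, 0 ≤ Q j u) (hP1 : ∀ j, ∑ u, P j u = 1) (hQ1 : ∀ j, ∑ u, Q j u = 1) :
    tvDist (tensorFun P) (tensorFun Q) ≤ ∑ j, tvDist (P j) (Q j) := by
  have h := tvDist_tensorFun_le_one_sub_prod P Q hP0 hQ0 hP1 hQ1
  have hw := one_sub_sum_le_prod_one_sub univ (fun j => tvDist (P j) (Q j))
    (fun j _ => tvDist_nonneg _ _) fun j _ => tvDist_le_one (hP0 j) (hQ0 j) (hP1 j) (hQ1 j)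
  linarith

/-- The i.i.d. case: `TV(P^{⊗n}, Q^{⊗n}) ≤ 1 − (1 − TV(P,Q))^n ≤ n · TV(P,Q)`.
[cite: PolyanskiyWu2024, Exercise I.43(b); Thm 7.7(b) eq. (7.20)] -/
theorem tvDist_tensorFun_const_le {Y : Type*} [Fintype Y] (n : ℕ) {P Q : Y → ℝ}
    (hP0 : ∀ y, 0 ≤ P y) (hQ0 : ∀ y, 0 ≤ Q y) (hP1 : ∑ y, P y = 1) (hQ1 : ∑ y, Q y = 1) :
    tvDist (tensorFun fun _ : Fin n => P) (tensorFun fun _ : Fin n => Q)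
        ≤ 1 - (1 - tvDist P Q) ^ n ∧
      tvDist (tensorFun fun _ : Fin n => P) (tensorFun fun _ : Fin n => Q) ≤ n * tvDist P Q := by
  constructor
  · have h := tvDist_tensorFun_le_one_sub_prod (fun _ : Fin n => P) (fun _ => Q) (fun _ => hP0)
      (fun _ => hQ0) (fun _ => hP1) fun _ => hQ1
    rwa [prod_const, card_univ, Fintype.card_fin] at h
  · have h := PolyanskiyWu2024_ex_I_43_b (fun _ : Fin n => P) (fun _ => Q) (fun _ => hP0)
      (fun _ => hQ0) (fun _ => hP1) fun _ => hQ1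
    rwa [sum_const, card_univ, Fintype.card_fin, nsmul_eq_mul] at h

/-! ## Pinsker's inequality for product laws (Thm 7.10 with Thm 2.16(d)) -/

/-- **Pinsker for products**: `2 · TV(P̃, Q̃)² ≤ Σ_j D(P_j ‖ Q_j)` for strictly positive laws.
[cite: PolyanskiyWu2024, Thm 7.10 (eq. (7.27)) with Thm 2.16(d)] -/
theorem two_mul_tvDist_tensorFun_sq_le [∀ j, DecidableEq (X j)] (P Q : ∀ j, X j → ℝ)
    (hP : ∀ j u, 0 < P j u) (hQ : ∀ j u, 0 < Q j u) (hP1 : ∀ j, ∑ u, P j u = 1)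
    (hQ1 : ∀ j, ∑ u, Q j u = 1) :
    2 * tvDist (tensorFun P) (tensorFun Q) ^ 2 ≤ ∑ j, relEnt (P j) (Q j) := by
  rw [← relEnt_tensorFun P Q hP1 fun j u => (hQ j u).ne']
  exact two_mul_tvDist_sq_le_kl (tensorFun_pos hP) (tensorFun_pos hQ) (sum_tensorFun_eq_one P hP1)
    (sum_tensorFun_eq_one Q hQ1)

/-- **Pinsker for products**, root form: `TV(P̃, Q̃) ≤ √(Σ_j D(P_j ‖ Q_j) / 2)`.
[cite: PolyanskiyWu2024, Thm 7.10 with Thm 2.16(d)] -/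
theorem tvDist_tensorFun_le_sqrt [∀ j, DecidableEq (X j)] (P Q : ∀ j, X j → ℝ)
    (hP : ∀ j u, 0 < P j u) (hQ : ∀ j u, 0 < Q j u) (hP1 : ∀ j, ∑ u, P j u = 1)
    (hQ1 : ∀ j, ∑ u, Q j u = 1) :
    tvDist (tensorFun P) (tensorFun Q) ≤ Real.sqrt ((∑ j, relEnt (P j) (Q j)) / 2) :=
  Real.le_sqrt_of_sq_le (by linarith [two_mul_tvDist_tensorFun_sq_le P Q hP hQ hP1 hQ1])

/-- The i.i.d. case: `TV(P^{⊗n}, Q^{⊗n}) ≤ √(n · D(P‖Q) / 2)` — the `√n` law.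
[cite: PolyanskiyWu2024, Thm 7.10 with Thm 2.16(d); §7.3] -/
theorem tvDist_tensorFun_const_le_sqrt {Y : Type*} [Fintype Y] [DecidableEq Y] (n : ℕ)
    {P Q : Y → ℝ} (hP : ∀ y, 0 < P y) (hQ : ∀ y, 0 < Q y) (hP1 : ∑ y, P y = 1)
    (hQ1 : ∑ y, Q y = 1) :
    tvDist (tensorFun fun _ : Fin n => P) (tensorFun fun _ : Fin n => Q)
      ≤ Real.sqrt (n * relEnt P Q / 2) := by
  have h := tvDist_tensorFun_le_sqrt (fun _ : Fin n => P) (fun _ => Q) (fun _ => hP) (fun _ => hQ)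
    (fun _ => hP1) fun _ => hQ1
  rwa [sum_const, card_univ, Fintype.card_fin, nsmul_eq_mul] at h

end Product

end Literature.Probability.Entropy
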